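import Summits.CriticalPhenomena.PercolationContinuityZ3.Theorems.PercNearOneGluingNoHeavyConstsLinearLowerTailGluedPartition
import HarnessLib

/-!
# The block criterion with imperfect gluing: `P(1 ≤ N < κ·EN) ≤ (3/2)·s + η`, `η` the total detachment defect

builds on p205010 (kernel theorem, internal audit signed; external expert review pending)

PAPER-2 track "percolation constants", part (ii), seat `prim-consts-1`, gen 11 (lane index `run/shared/lean/prim/consts/CONSTANTS.md`,
row A19, §4 N37; memo `FROM-prim-consts-1-g11-GLUED-BLOCK.md`).  Support file for the crux `NoHeavyLowerTail` (stmt-CriticalPhenomena-4575;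
`--supports`): theorems only, no definitions, no sorries, standard axioms.  Fourth file of the block method
(`…GluedBlock`, `…TwoGluedBlocks`, `…GluedPartition`): the same statements WITHOUT exact gluing.

Notation: finite weighted graph on `Fin n` (`μ = prodBernoulli w`), relay set `A`, observer `o` (no hypothesis), `N = |C(o) ∩ A|`,
`EN = Σ_{a∈A} P(o ↔ a)`, `s ≥ max_{a,a'∈A} P(a ↮ a')`, bad event `{1 ≤ N < κ·EN}`, `0 < κ ≤ 2/3`; ANCHOR MAP `c : Fin n → Fin n`
(arbitrary — every relay point `a` is "assigned" to `c a`; free points: `c a = a`), DETACHMENT DEFECT `η := Σ_{a∈A} P(c(a) ↮ a)`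
(`= 0` for an almost surely glued partition; `= Σ_{b∈B} (1 − w(s(t,b)))`-type bounds for a block joined to `t` by heavy edges).

THE POINT.  In `…GluedPartition` the gluing enters only through the null set `Z = ⋃_{a∈A} {c(a) ↮ a}` off which blocks move as units;
replacing `μ(Z) = 0` by `μ(Z) ≤ η` costs an additive `η` in every block-deficit bound and hence in the conclusion (the footprint transfer
is linear in the deficit bound).  So for EVERY instance and EVERY anchor map satisfying the watched-points criterion of
`Consts.real_lowerTail_le_three_halves_of_block_criterion`:  `P(1 ≤ N < κ·EN) ≤ (3/2)·s + η`.  This makes the block classes "physical":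
weights `< 1` are allowed, at a price proportional to the total unreliability of the intra-block attachments — compare the robust forms
of the glued-fraction theorem (`Consts.real_lowerTail_le_stabbed_add_detach`, `…GluedFraction`), whose defect is the same `η` for two
marked points.
* `Consts.real_le_three_halves_add_of_two_lost` — finishing step with defect: `E ∩ Zᶜ ⊆ {two entries lost}`, `μ(Z) ≤ η` ⇒ `μ(E) ≤ (3/2)s + η`.
* `Consts.real_blockDeficit_le_add_of_two_watched`, `…_of_four_watched` — deficit bounds `μ(N_a < k) ≤ (3/2)s + η`.
* `Consts.real_lowerTail_le_three_halves_add_of_block_criterion` — `P(1 ≤ N < κ·EN) ≤ (3/2)·s + η` under the criterion (any observer).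
* `Consts.real_lowerTail_le_three_halves_add_of_two_blocks` — two disjoint nonempty blocks `B₁, B₂` ASSIGNED to `t₁, t₂` (no gluing
  assumed) with `2·|A ∖ (B₁ ∪ B₂)| ≤ |B₁| + |B₂| + 3`:  `P(1 ≤ N < κ·EN) ≤ (3/2)·s + Σ_{b∈B₁} P(t₁ ↮ b) + Σ_{b∈B₂} P(t₂ ↮ b)`.
* `Consts.real_lowerTail_le_three_halves_add_of_block` — one assigned block `B` (to `t`) with `2·|A ∖ B| ≤ |B| + 6`:
  `P(1 ≤ N < κ·EN) ≤ (3/2)·s + Σ_{b∈B} P(t ↮ b)` — e.g. a vertex `t` joined to `β` relay points by edges of weight `1 − ε` each and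
  `f ≤ β/2 + 3` further relay points anywhere: `≤ (3/2)s + βε`.
References: G. Kozma, N. Nitzan, arXiv:2401.12397 (2024), Conjecture 1 (p. 3), Conjecture 4 (p. 32); J. van den Berg, O. Häggström,
J. Kahn, Random Structures Algorithms 29 (2006), Thm. 1.3; G. Grimmett, *Percolation* (1999), §1.3.
-/

noncomputable section

namespace Summit.CriticalPhenomena.PercolationContinuityZ3.Theorems

open MeasureTheory Set Literature.Probability.LatticeModels Literature.Probability.Percolation
open scoped Classical

namespace Consts

/-- **Finishing step with defect.**  If `μ(Z) ≤ η` and, off `Z`, the event `E` forces the relay point `a ∈ A` to be cut from two entries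
of a fixed quadruple `x : Fin 4 → A ∖ {a}` (repetitions allowed), then `μ(E) ≤ (3/2)·s + η`.
[cite: VandenbergHaggstromKahn2005, Thm. 1.3 (p. 6)] -/
theorem real_le_three_halves_add_of_two_lost (n : ℕ) (w : Sym2 (Fin n) → unitInterval) (A : Finset (Fin n)) (a : Fin n)
    (ha : a ∈ A) {s : ℝ} (hrel : ∀ b ∈ A, ∀ b' ∈ A, (prodBernoulli w).real (openConn b b')ᶜ ≤ s)
    (x : Fin 4 → Fin n) (hxA : ∀ k, x k ∈ A) (hxa : ∀ k, x k ≠ a)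
    (Z E : Set (BondConfig (Fin n))) {η : ℝ} (hZ : (prodBernoulli w).real Z ≤ η)
    (hsub : E ∩ Zᶜ ⊆ {ω | 2 ≤ (Finset.univ.filter fun k => ω ∉ openConn a (x k)).card}) :
    (prodBernoulli w).real E ≤ 3 / 2 * s + η := by
  set μ := prodBernoulli w with hμ
  have hsplit : E ⊆ E ∩ Zᶜ ∪ Z := by
    intro ω hω
    by_cases hz : ω ∈ Z
    · exact Or.inr hz
    · exact Or.inl ⟨hω, hz⟩
  calc μ.real E ≤ μ.real (E ∩ Zᶜ ∪ Z) := measureReal_mono hsplit (measure_ne_top _ _)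
    _ ≤ μ.real (E ∩ Zᶜ) + μ.real Z := measureReal_union_le _ _
    _ ≤ 3 / 2 * s + η := add_le_add ((measureReal_mono hsub (measure_ne_top _ _)).trans
        (real_two_le_lost_le_three_halves n w a x hxa (fun k => hrel a ha (x k) (hxA k))
          (fun k k' => hrel (x k) (hxA k) (x k') (hxA k')))) hZ

/-- The defect bound for the anchor null set: `μ(⋃_{b∈A} {c b ↮ b}) ≤ Σ_{b∈A} P(c b ↮ b)`. [folklore] -/
theorem real_biUnion_compl_openConn_anchor_le (n : ℕ) (w : Sym2 (Fin n) → unitInterval) (A : Finset (Fin n))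
    (c : Fin n → Fin n) :
    (prodBernoulli w).real (⋃ b ∈ A, (openConn (c b) b)ᶜ) ≤ ∑ b ∈ A, (prodBernoulli w).real (openConn (c b) b)ᶜ :=
  measureReal_biUnion_finset_le _ _

/-! ### Deficit bounds with defect -/

/-- **Two watched points, with defect.**  Any anchor map `c`; `a ∈ A`; `y, z ∈ A ∖ {a}`; the relay points outside the blocks of
`a, y, z` number at most `|A| − k`.  Then `μ(N_a < k) ≤ (3/2)·s + Σ_{b∈A} P(c b ↮ b)`. [cite: KozmaNitzan2024, Conj. 4 (p. 32)] -/
theorem real_blockDeficit_le_add_of_two_watched (n : ℕ) (w : Sym2 (Fin n) → unitInterval) (A : Finset (Fin n))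
    (c : Fin n → Fin n) (k : ℕ) {s : ℝ} (hrel : ∀ b ∈ A, ∀ b' ∈ A, (prodBernoulli w).real (openConn b b')ᶜ ≤ s)
    (a : Fin n) (ha : a ∈ A) (y z : Fin n) (hy : y ∈ A) (hz : z ∈ A) (hya : y ≠ a) (hza : z ≠ a)
    (hmass : (A.filter fun b => c b ≠ c a ∧ c b ≠ c y ∧ c b ≠ c z).card + k ≤ A.card) :
    (prodBernoulli w).real {ω : BondConfig (Fin n) | (A.filter fun b => ω ∈ openConn a b).card < k} ≤
      3 / 2 * s + ∑ b ∈ A, (prodBernoulli w).real (openConn (c b) b)ᶜ := by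
  refine real_le_three_halves_add_of_two_lost n w A a ha hrel ![y, y, z, z]
    (fun j => by fin_cases j <;> simp [hy, hz]) (fun j => by fin_cases j <;> simp [hya, hza]) _ _
    (real_biUnion_compl_openConn_anchor_le n w A c) ?_
  rintro ω ⟨hN, hωZ⟩
  simp only [mem_setOf_eq] at hN ⊢
  have hatt : ∀ b ∈ A, ω ∈ openConn (c b) b := by
    intro b hb
    by_contra h
    exact hωZ (Set.mem_iUnion₂.2 ⟨b, hb, h⟩)
  obtain ⟨hclosed, hown⟩ := lostSet_closed_of_anchor A c a ha ω hatt
  by_cases hy' : ω ∈ openConn a y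
  · by_cases hz' : ω ∈ openConn a z
    · exfalso
      refine not_blockDeficit_of_lostSet_subset A _ a ω k ?_ hmass hN
      intro b hb
      have hb' := Finset.mem_filter.1 hb
      refine Finset.mem_filter.2 ⟨hb'.1, fun h => hb'.2 (hown b hb'.1 h), fun h => hb'.2 ?_, fun h => hb'.2 ?_⟩
      · by_contra hab
        exact hclosed b hb'.1 y hy h.symm hab hy'
      · by_contra hab
        exact hclosed b hb'.1 z hz h.symm hab hz'
    · refine Finset.one_lt_card.2 ⟨2, ?_, 3, ?_, by decide⟩ <;> simp [hz']
  · refine Finset.one_lt_card.2 ⟨0, ?_, 1, ?_, by decide⟩ <;> simp [hy']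

/-- **Four watched points, with defect.**  Any anchor map `c`; `a ∈ A`; `y₀, …, y₃ ∈ A ∖ {a}` such that for every `j₀` the relay points
outside the blocks of `a` and of the `y_j`, `j ≠ j₀`, number at most `|A| − k`.  Then `μ(N_a < k) ≤ (3/2)·s + Σ_{b∈A} P(c b ↮ b)`
(five-point lemma, vdBHK Thm. 1.3). [cite: VandenbergHaggstromKahn2005, Thm. 1.3 (p. 6)] -/
theorem real_blockDeficit_le_add_of_four_watched (n : ℕ) (w : Sym2 (Fin n) → unitInterval) (A : Finset (Fin n))
    (c : Fin n → Fin n) (k : ℕ) {s : ℝ} (hrel : ∀ b ∈ A, ∀ b' ∈ A, (prodBernoulli w).real (openConn b b')ᶜ ≤ s)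
    (a : Fin n) (ha : a ∈ A) (y : Fin 4 → Fin n) (hyA : ∀ j, y j ∈ A) (hya : ∀ j, y j ≠ a)
    (hmass : ∀ j₀ : Fin 4, (A.filter fun b => c b ≠ c a ∧ ∀ j, j ≠ j₀ → c b ≠ c (y j)).card + k ≤ A.card) :
    (prodBernoulli w).real {ω : BondConfig (Fin n) | (A.filter fun b => ω ∈ openConn a b).card < k} ≤
      3 / 2 * s + ∑ b ∈ A, (prodBernoulli w).real (openConn (c b) b)ᶜ := by
  refine real_le_three_halves_add_of_two_lost n w A a ha hrel y hyA hya _ _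
    (real_biUnion_compl_openConn_anchor_le n w A c) ?_
  rintro ω ⟨hN, hωZ⟩
  simp only [mem_setOf_eq] at hN ⊢
  have hatt : ∀ b ∈ A, ω ∈ openConn (c b) b := by
    intro b hb
    by_contra h
    exact hωZ (Set.mem_iUnion₂.2 ⟨b, hb, h⟩)
  obtain ⟨hclosed, hown⟩ := lostSet_closed_of_anchor A c a ha ω hatt
  by_contra hlt
  push Not at hlt
  have hle1 : (Finset.univ.filter fun j => ω ∉ openConn a (y j)).card ≤ 1 := Nat.lt_succ_iff.mp hlt
  obtain ⟨j₀, hj₀⟩ : ∃ j₀ : Fin 4, ∀ j, j ≠ j₀ → ω ∈ openConn a (y j) := by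
    by_cases h0 : (Finset.univ.filter fun j => ω ∉ openConn a (y j)).card = 0
    · refine ⟨0, fun j _ => ?_⟩
      by_contra hj
      have : j ∈ (Finset.univ.filter fun j => ω ∉ openConn a (y j)) := Finset.mem_filter.2 ⟨Finset.mem_univ _, hj⟩
      rw [Finset.card_eq_zero.1 h0] at this
      exact absurd this (Finset.notMem_empty _)
    · have h1 : (Finset.univ.filter fun j => ω ∉ openConn a (y j)).card = 1 := by omega
      obtain ⟨j₀, hj₀⟩ := Finset.card_eq_one.1 h1
      refine ⟨j₀, fun j hj => ?_⟩
      by_contra hj'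
      have : j ∈ (Finset.univ.filter fun j => ω ∉ openConn a (y j)) := Finset.mem_filter.2 ⟨Finset.mem_univ _, hj'⟩
      rw [hj₀] at this
      exact hj (Finset.mem_singleton.1 this)
  refine not_blockDeficit_of_lostSet_subset A _ a ω k ?_ (hmass j₀) hN
  intro b hb
  have hb' := Finset.mem_filter.1 hb
  refine Finset.mem_filter.2 ⟨hb'.1, fun h => hb'.2 (hown b hb'.1 h), fun j hj h => hb'.2 ?_⟩
  by_contra hab
  exact hclosed b hb'.1 (y j) (hyA j) h.symm hab (hj₀ j hj)

/-! ### (LT³⁄₂) up to the defect -/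

/-- **`P(1 ≤ N < κ·EN) ≤ (3/2)·s + η` under the block criterion, ANY anchor map, ANY observer, every `0 < κ ≤ 2/3`**, where
`η = Σ_{a∈A} P(c(a) ↮ a)` is the total detachment defect of the assignment `c` (no gluing assumed).  Criterion as in
`Consts.real_lowerTail_le_three_halves_of_block_criterion` (two or four watched points at every relay point, masses `≤ ⌊|A|/3⌋`).
[cite: KozmaNitzan2024, Conj. 1 (p. 3)] -/
theorem real_lowerTail_le_three_halves_add_of_block_criterion (n : ℕ) (w : Sym2 (Fin n) → unitInterval) (A : Finset (Fin n))
    (o : Fin n) (c : Fin n → Fin n)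
    (hcrit : ∀ a ∈ A,
      (∃ y ∈ A, ∃ z ∈ A, y ≠ a ∧ z ≠ a ∧
          (A.filter fun b => c b ≠ c a ∧ c b ≠ c y ∧ c b ≠ c z).card ≤ A.card / 3) ∨
      (∃ y : Fin 4 → Fin n, (∀ j, y j ∈ A) ∧ (∀ j, y j ≠ a) ∧
          ∀ j₀ : Fin 4, (A.filter fun b => c b ≠ c a ∧ ∀ j, j ≠ j₀ → c b ≠ c (y j)).card ≤ A.card / 3))
    {κ s : ℝ} (hκ0 : 0 < κ) (hκ : κ ≤ 2 / 3) (hs : 0 ≤ s)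
    (hrel : ∀ a ∈ A, ∀ a' ∈ A, (prodBernoulli w).real (openConn a a')ᶜ ≤ s) :
    (prodBernoulli w).real {ω : BondConfig (Fin n) | 1 ≤ (A.filter fun a => ω ∈ openConn o a).card ∧
        ((A.filter fun a => ω ∈ openConn o a).card : ℝ) < κ * (∑ a ∈ A, (prodBernoulli w).real (openConn o a))} ≤
      3 / 2 * s + ∑ b ∈ A, (prodBernoulli w).real (openConn (c b) b)ᶜ := by
  set μ := prodBernoulli w with hμ
  set η := ∑ b ∈ A, μ.real (openConn (c b) b)ᶜ with hη
  have hη0 : 0 ≤ η := Finset.sum_nonneg fun b _ => measureReal_nonneg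
  set k : ℕ := A.card - A.card / 3 with hk
  have hblk : ∀ a ∈ A, μ.real {ω : BondConfig (Fin n) | (A.filter fun b => ω ∈ openConn a b).card < k} ≤ 3 / 2 * s + η := by
    intro a ha
    rcases hcrit a ha with ⟨y, hy, z, hz, hya, hza, hmass⟩ | ⟨y, hyA, hya, hmass⟩
    · exact real_blockDeficit_le_add_of_two_watched n w A c k hrel a ha y z hy hz hya hza (by omega)
    · exact real_blockDeficit_le_add_of_four_watched n w A c k hrel a ha y hyA hya (fun j₀ => by have := hmass j₀; omega)
  have htr := lowerTail_le_blockDeficit n w A o k (3 / 2 * s + η) hblk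
  have h32 : (3 / 2 * s + η) * μ.real (⋃ a ∈ A, openConn o a) ≤ 3 / 2 * s + η := by
    have h0 : 0 ≤ 3 / 2 * s + η := by linarith
    have h1 : μ.real (⋃ a ∈ A, openConn o a) ≤ 1 := measureReal_le_one
    nlinarith [measureReal_nonneg (μ := μ) (s := ⋃ a ∈ A, openConn o a)]
  exact le_trans (measureReal_mono (lowerTail_subset_threshold n w A o hκ0 hκ)) (htr.trans h32)

/-- **Two assigned blocks, no gluing assumed.**  Disjoint nonempty `B₁, B₂ ⊆ A`, vertices `t₁, t₂`, free part `F = A ∖ (B₁ ∪ B₂)` with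
`2·|F| ≤ |B₁| + |B₂| + 3`.  Then for every observer and every `0 < κ ≤ 2/3`:
`P(1 ≤ N < κ·EN) ≤ (3/2)·s + Σ_{b∈B₁} P(t₁ ↮ b) + Σ_{b∈B₂} P(t₂ ↮ b)`.
(`|A| ≤ 6`: `(3/2)s` already; else the criterion with anchors `t₁` on `B₁`, `t₂` on `B₂`, identity on `F`, watched points as in
`…TwoGluedBlocks`.) [cite: KozmaNitzan2024, Conj. 1 (p. 3)] -/
theorem real_lowerTail_le_three_halves_add_of_two_blocks (n : ℕ) (w : Sym2 (Fin n) → unitInterval) (A : Finset (Fin n))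
    (o t₁ t₂ : Fin n) (B₁ B₂ : Finset (Fin n)) (hB₁A : B₁ ⊆ A) (hB₂A : B₂ ⊆ A) (hdisj : Disjoint B₁ B₂)
    (hne₁ : B₁.Nonempty) (hne₂ : B₂.Nonempty) (hF : 2 * (A \ (B₁ ∪ B₂)).card ≤ B₁.card + B₂.card + 3)
    {κ s : ℝ} (hκ0 : 0 < κ) (hκ : κ ≤ 2 / 3) (hs : 0 ≤ s)
    (hrel : ∀ a ∈ A, ∀ a' ∈ A, (prodBernoulli w).real (openConn a a')ᶜ ≤ s) :
    (prodBernoulli w).real {ω : BondConfig (Fin n) | 1 ≤ (A.filter fun a => ω ∈ openConn o a).card ∧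
        ((A.filter fun a => ω ∈ openConn o a).card : ℝ) < κ * (∑ a ∈ A, (prodBernoulli w).real (openConn o a))} ≤
      3 / 2 * s + (∑ b ∈ B₁, (prodBernoulli w).real (openConn t₁ b)ᶜ + ∑ b ∈ B₂, (prodBernoulli w).real (openConn t₂ b)ᶜ) := by
  set μ := prodBernoulli w with hμ
  have hη0 : 0 ≤ ∑ b ∈ B₁, μ.real (openConn t₁ b)ᶜ + ∑ b ∈ B₂, μ.real (openConn t₂ b)ᶜ :=
    add_nonneg (Finset.sum_nonneg fun b _ => measureReal_nonneg) (Finset.sum_nonneg fun b _ => measureReal_nonneg)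
  by_cases hA6 : A.card ≤ 6
  · exact (real_lowerTail_le_three_halves_of_card_le_six_any n w A o hA6 hκ0 hκ hs hrel).trans (le_add_of_nonneg_right hη0)
  set F := A \ (B₁ ∪ B₂) with hFdef
  set c : Fin n → Fin n := fun v => if v ∈ B₁ then t₁ else if v ∈ B₂ then t₂ else v with hcdef
  have hc₁ : ∀ b ∈ B₁, c b = t₁ := fun b hb => by simp [hcdef, hb]
  have hc₂ : ∀ b ∈ B₂, c b = t₂ := fun b hb => by
    have : b ∉ B₁ := Finset.disjoint_right.1 hdisj hb
    simp [hcdef, hb, this]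
  have hcF : ∀ b ∈ F, c b = b := fun b hb => by
    have hb' := (Finset.mem_sdiff.1 hb).2
    simp only [Finset.mem_union, not_or] at hb'
    simp [hcdef, hb'.1, hb'.2]
  have hmemF : ∀ b ∈ A, b ∉ B₁ → b ∉ B₂ → b ∈ F := fun b hb h1 h2 => Finset.mem_sdiff.2 ⟨hb, by simp [h1, h2]⟩
  -- the defect of `c` is the sum of the two block defects
  have hη : ∑ b ∈ A, μ.real (openConn (c b) b)ᶜ =
      ∑ b ∈ B₁, μ.real (openConn t₁ b)ᶜ + ∑ b ∈ B₂, μ.real (openConn t₂ b)ᶜ := by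
    have hA : A = (B₁ ∪ B₂) ∪ F := by
      rw [hFdef, Finset.union_sdiff_of_subset (Finset.union_subset hB₁A hB₂A)]
    have hdF : Disjoint (B₁ ∪ B₂) F := by rw [hFdef]; exact Finset.disjoint_sdiff
    have h0 : ∑ b ∈ F, μ.real (openConn (c b) b)ᶜ = 0 := by
      refine Finset.sum_eq_zero fun b hb => ?_
      rw [hcF b hb]
      have : (openConn b b : Set (BondConfig (Fin n))) = univ := Set.eq_univ_of_forall fun ω => SimpleGraph.Reachable.refl _
      rw [this, Set.compl_univ, measureReal_empty]
    have h1 : ∑ b ∈ B₁, μ.real (openConn (c b) b)ᶜ = ∑ b ∈ B₁, μ.real (openConn t₁ b)ᶜ :=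
      Finset.sum_congr rfl fun b hb => by rw [hc₁ b hb]
    have h2 : ∑ b ∈ B₂, μ.real (openConn (c b) b)ᶜ = ∑ b ∈ B₂, μ.real (openConn t₂ b)ᶜ :=
      Finset.sum_congr rfl fun b hb => by rw [hc₂ b hb]
    rw [hA, Finset.sum_union hdF, Finset.sum_union hdisj, h0, add_zero, h1, h2]
  rw [← hη]
  have hFA : F.card + (B₁ ∪ B₂).card = A.card := Finset.card_sdiff_add_card_eq_card (Finset.union_subset hB₁A hB₂A)
  have hU : (B₁ ∪ B₂).card = B₁.card + B₂.card := Finset.card_union_of_disjoint hdisj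
  obtain ⟨b₁, hb₁⟩ := hne₁
  obtain ⟨b₂, hb₂⟩ := hne₂
  have hcb₁ := hc₁ b₁ hb₁
  have hcb₂ := hc₂ b₂ hb₂
  refine real_lowerTail_le_three_halves_add_of_block_criterion n w A o c (fun a ha => ?_) hκ0 hκ hs hrel
  -- a relay point whose anchor is neither `t₁` nor `t₂` is free
  have key : ∀ b ∈ A, c b ≠ t₁ → c b ≠ t₂ → b ∈ F := fun b hb h1 h2 =>
    hmemF b hb (fun h => h1 (hc₁ b h)) (fun h => h2 (hc₂ b h))
  -- a free point for the block cases
  obtain ⟨y, hyA, hyF, hy1⟩ : ∃ y, y ∈ A ∧ (F.Nonempty → y ∈ F) ∧ y ∉ B₁ := by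
    by_cases hne : F.Nonempty
    · obtain ⟨y, hy⟩ := hne
      have hy' := Finset.mem_sdiff.1 hy
      exact ⟨y, hy'.1, fun _ => hy, fun h => hy'.2 (Finset.mem_union_left _ h)⟩
    · exact ⟨b₂, hB₂A hb₂, fun h => absurd h hne, Finset.disjoint_right.1 hdisj hb₂⟩
  by_cases ha₁ : a ∈ B₁
  · -- watch `b₂` and `y`: admissible mass ⊆ `F ∖ {y}` (or `F` if `F = ∅`)
    refine Or.inl ⟨b₂, hB₂A hb₂, y, hyA, fun h => Finset.disjoint_left.1 hdisj ha₁ (h ▸ hb₂), fun h => hy1 (h ▸ ha₁), ?_⟩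
    by_cases hne : F.Nonempty
    · have hyF' := hyF hne
      calc (A.filter fun b => c b ≠ c a ∧ c b ≠ c b₂ ∧ c b ≠ c y).card ≤ (F.erase y).card :=
            Finset.card_le_card fun b hb => by
              have hb' := Finset.mem_filter.1 hb
              rw [hc₁ a ha₁, hcb₂, hcF y hyF'] at hb'
              have hbF : b ∈ F := key b hb'.1 hb'.2.1 hb'.2.2.1
              refine Finset.mem_erase.2 ⟨fun h => hb'.2.2.2 ?_, hbF⟩
              rw [hcF b hbF, h]
        _ ≤ A.card / 3 := by rw [Finset.card_erase_of_mem (hyF hne)]; have := Finset.card_pos.2 hne; omega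
    · have hF0 : F.card = 0 := Finset.card_eq_zero.2 (Finset.not_nonempty_iff_eq_empty.1 hne)
      calc (A.filter fun b => c b ≠ c a ∧ c b ≠ c b₂ ∧ c b ≠ c y).card ≤ F.card :=
            Finset.card_le_card fun b hb => by
              have hb' := Finset.mem_filter.1 hb
              rw [hc₁ a ha₁, hcb₂] at hb'
              exact key b hb'.1 hb'.2.1 hb'.2.2.1
        _ ≤ A.card / 3 := by omega
  by_cases ha₂ : a ∈ B₂
  · -- watch `b₁` and a free point `y'` outside `B₂`
    obtain ⟨y', hy'A, hy'F, hy'2⟩ : ∃ y', y' ∈ A ∧ (F.Nonempty → y' ∈ F) ∧ y' ∉ B₂ := by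
      by_cases hne : F.Nonempty
      · obtain ⟨y', hy'⟩ := hne
        have h' := Finset.mem_sdiff.1 hy'
        exact ⟨y', h'.1, fun _ => hy', fun h => h'.2 (Finset.mem_union_right _ h)⟩
      · exact ⟨b₁, hB₁A hb₁, fun h => absurd h hne, Finset.disjoint_left.1 hdisj hb₁⟩
    refine Or.inl ⟨b₁, hB₁A hb₁, y', hy'A, fun h => ha₁ (h ▸ hb₁), fun h => hy'2 (h ▸ ha₂), ?_⟩
    by_cases hne : F.Nonempty
    · have hyF' := hy'F hne
      calc (A.filter fun b => c b ≠ c a ∧ c b ≠ c b₁ ∧ c b ≠ c y').card ≤ (F.erase y').card :=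
            Finset.card_le_card fun b hb => by
              have hb' := Finset.mem_filter.1 hb
              rw [hc₂ a ha₂, hcb₁, hcF y' hyF'] at hb'
              have hbF : b ∈ F := key b hb'.1 hb'.2.2.1 hb'.2.1
              refine Finset.mem_erase.2 ⟨fun h => hb'.2.2.2 ?_, hbF⟩
              rw [hcF b hbF, h]
        _ ≤ A.card / 3 := by rw [Finset.card_erase_of_mem hyF']; have := Finset.card_pos.2 hne; omega
    · have hF0 : F.card = 0 := Finset.card_eq_zero.2 (Finset.not_nonempty_iff_eq_empty.1 hne)
      calc (A.filter fun b => c b ≠ c a ∧ c b ≠ c b₁ ∧ c b ≠ c y').card ≤ F.card :=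
            Finset.card_le_card fun b hb => by
              have hb' := Finset.mem_filter.1 hb
              rw [hc₂ a ha₂, hcb₁] at hb'
              exact key b hb'.1 hb'.2.2.1 hb'.2.1
        _ ≤ A.card / 3 := by omega
  · -- `a` free: watch `b₁, b₂`: admissible mass ⊆ `F ∖ {a}`
    have haF : a ∈ F := hmemF a ha ha₁ ha₂
    refine Or.inl ⟨b₁, hB₁A hb₁, b₂, hB₂A hb₂, fun h => ha₁ (h ▸ hb₁), fun h => ha₂ (h ▸ hb₂), ?_⟩
    calc (A.filter fun b => c b ≠ c a ∧ c b ≠ c b₁ ∧ c b ≠ c b₂).card ≤ (F.erase a).card :=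
          Finset.card_le_card fun b hb => by
            have hb' := Finset.mem_filter.1 hb
            rw [hcF a haF, hcb₁, hcb₂] at hb'
            have hbF : b ∈ F := key b hb'.1 hb'.2.2.1 hb'.2.2.2
            refine Finset.mem_erase.2 ⟨fun h => hb'.2.1 ?_, hbF⟩
            rw [hcF b hbF, h]
      _ ≤ A.card / 3 := by rw [Finset.card_erase_of_mem haF]; omega

/-- **One assigned block, no gluing assumed.**  `B ⊆ A` nonempty, a vertex `t`, `2·|A ∖ B| ≤ |B| + 6`.  Then for every observer and every
`0 < κ ≤ 2/3`:  `P(1 ≤ N < κ·EN) ≤ (3/2)·s + Σ_{b∈B} P(t ↮ b)`.  (A free point, or a point of `B` if there is none, serves as the second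
block of `Consts.real_lowerTail_le_three_halves_add_of_two_blocks`.) [cite: KozmaNitzan2024, Conj. 1 (p. 3)] -/
theorem real_lowerTail_le_three_halves_add_of_block (n : ℕ) (w : Sym2 (Fin n) → unitInterval) (A : Finset (Fin n))
    (o t : Fin n) (B : Finset (Fin n)) (hBA : B ⊆ A) (hne : B.Nonempty) (hF : 2 * (A \ B).card ≤ B.card + 6)
    {κ s : ℝ} (hκ0 : 0 < κ) (hκ : κ ≤ 2 / 3) (hs : 0 ≤ s)
    (hrel : ∀ a ∈ A, ∀ a' ∈ A, (prodBernoulli w).real (openConn a a')ᶜ ≤ s) :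
    (prodBernoulli w).real {ω : BondConfig (Fin n) | 1 ≤ (A.filter fun a => ω ∈ openConn o a).card ∧
        ((A.filter fun a => ω ∈ openConn o a).card : ℝ) < κ * (∑ a ∈ A, (prodBernoulli w).real (openConn o a))} ≤
      3 / 2 * s + ∑ b ∈ B, (prodBernoulli w).real (openConn t b)ᶜ := by
  have hself : ∀ d : Fin n, (prodBernoulli w).real (openConn d d)ᶜ = 0 := fun d => by
    have : (openConn d d : Set (BondConfig (Fin n))) = univ := Set.eq_univ_of_forall fun ω => SimpleGraph.Reachable.refl _
    rw [this, Set.compl_univ, measureReal_empty]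
  have hη0 : 0 ≤ ∑ b ∈ B, (prodBernoulli w).real (openConn t b)ᶜ := Finset.sum_nonneg fun b _ => measureReal_nonneg
  by_cases hA6 : A.card ≤ 6
  · exact (real_lowerTail_le_three_halves_of_card_le_six_any n w A o hA6 hκ0 hκ hs hrel).trans (le_add_of_nonneg_right hη0)
  have hBF := Finset.card_sdiff_add_card_eq_card hBA
  by_cases hFe : (A \ B).Nonempty
  · -- second block: a free singleton `{d}` assigned to itself (defect `0`)
    obtain ⟨d, hd⟩ := hFe
    have hd' := Finset.mem_sdiff.1 hd
    have hdisj : Disjoint B {d} := Finset.disjoint_singleton_right.2 hd'.2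
    have h1 : A \ (B ∪ {d}) = (A \ B).erase d := by
      ext b
      simp only [Finset.mem_sdiff, Finset.mem_union, Finset.mem_singleton, Finset.mem_erase]
      tauto
    have hcard : 2 * (A \ (B ∪ {d})).card ≤ B.card + ({d} : Finset (Fin n)).card + 3 := by
      rw [h1, Finset.card_erase_of_mem hd, Finset.card_singleton]
      have := Finset.card_pos.2 ⟨d, hd⟩
      omega
    have h := real_lowerTail_le_three_halves_add_of_two_blocks n w A o t d B {d} hBA (Finset.singleton_subset_iff.2 hd'.1)
      hdisj hne (Finset.singleton_nonempty d) hcard hκ0 hκ hs hrel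
    rw [Finset.sum_singleton, hself d, add_zero] at h
    exact h
  · -- no free point: split off one block point as the second block, both assigned to `t`
    have hF0 : (A \ B).card = 0 := Finset.card_eq_zero.2 (Finset.not_nonempty_iff_eq_empty.1 hFe)
    obtain ⟨b₀, hb₀⟩ := hne
    have hB2 : (B.erase b₀).Nonempty := by
      rw [← Finset.card_pos, Finset.card_erase_of_mem hb₀]; omega
    have hdisj : Disjoint (B.erase b₀) {b₀} := Finset.disjoint_singleton_right.2 (Finset.notMem_erase b₀ B)
    have hU : B.erase b₀ ∪ {b₀} = B := by
      rw [Finset.union_comm, ← Finset.insert_eq]; exact Finset.insert_erase hb₀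
    have hcard : 2 * (A \ (B.erase b₀ ∪ {b₀})).card ≤ (B.erase b₀).card + ({b₀} : Finset (Fin n)).card + 3 := by
      rw [hU, hF0, Finset.card_erase_of_mem hb₀, Finset.card_singleton]; omega
    have h := real_lowerTail_le_three_halves_add_of_two_blocks n w A o t t (B.erase b₀) {b₀}
      ((Finset.erase_subset _ _).trans hBA) (Finset.singleton_subset_iff.2 (hBA hb₀)) hdisj hB2 (Finset.singleton_nonempty b₀)
      hcard hκ0 hκ hs hrel
    rw [Finset.sum_singleton] at h
    rw [← Finset.sum_erase_add _ _ hb₀]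
    exact h

end Consts

end Summit.CriticalPhenomena.PercolationContinuityZ3.Theorems
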